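import Literature.Geometry.Kaehler.ComplexTorusIntegralHodgeLatticeLefschetzPiecesIndexLowerBound
import Mathlib.GroupTheory.IndexNSmul
import HarnessLib

/-!
# The integral Lefschetz decomposition with MINIMAL classes `γ_s = θ^{∧s}/(s!·d₁⋯d_s)` and the factorisation of its index:
# `[Hdgᵖ(X, ℤ) : ⊕_s θ^{∧s} ∧ Hdg^{p−s}(X, ℤ)_prim] = [Hdgᵖ(X, ℤ) : ⊕_s γ_s ∧ Hdg^{p−s}(X, ℤ)_prim] · ∏_{s ≤ p} (s!·d₁⋯d_s)^{ρ_pr^{(p−s)}}`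

Layer `Literature/Geometry/Kaehler`, namespace `Literature.Geometry.Kaehler.ComplexTorus`; lane `lit-hodgefound`
(Track 2 foundations library), seat p09, generation 48, row g48-#4. THEOREMS ONLY (0 definitions); no named fact, net debt 0.
g48-#3 (`ComplexTorusIntegralHodgeLatticeLefschetzPiecesIndexLowerBound`) showed that the top Lefschetz piece `ℤ·θ^{∧p}` of `Hdgᵖ(X, ℤ)` is divisible by the
content `p!·d₁⋯d_p` of the type inside `H^{2p}(X, ℤ)` (the minimal class `γ_p` is integral), forcing `p!·d₁⋯d_p ∣ I_p`. The same happens on EVERY piece: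
`θ^{∧s} ∧ y = (s!·d₁⋯d_s) · (γ_s ∧ y)` with `γ_s ∧ y ∈ H^{2p}(X, ℤ)`. Replacing the pieces `N_s = Lˢ Hdg^{p−s}(X, ℤ)_prim` (g47-#3) by the MINIMAL-CLASS PIECES
`M_s := {u ∈ Hᵏ(X, ℤ) : (s!·d₁⋯d_s)·u ∈ N_s} = γ_s ∧ Hdg^{p−s}(X, ℤ)_prim` (the lineage's g40-#4 `ComplexTorusIntegralLefschetzDecompositionCodegreeMinimalClassIndex` did this
for the full lattice in codegrees `2, 3`), for a polarised abelian variety of dimension `g = j + 2`, type `(d₁, …, d_g)`, `k = p + p ≤ g`: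

* §0 LATTICE GENERALITIES: **`[⊕_s A_s : ⊕_s B_s] = ∏_s [A_s : B_s]`** for an INDEPENDENT finite family of sublattices `A` and `B_s ⊆ A_s`
  (`relIndex_iSup_eq_prod_of_iSupIndep`; modular law + second isomorphism theorem, by induction over the summands); **`[Λ : n·Λ] = n^{rk Λ}`** for a
  free lattice `Λ` with a finite basis (`relIndex_map_nsmul_eq_pow_card`, Mathlib's `AddSubgroup.relIndex_map_nsmul` repackaged for sublattices with a basis).
* §1 THE MINIMAL-CLASS PIECES `M_s` (membership predicate `(s!·d₁⋯d_s)·u ∈ N_s`; they exist, `exists_family_mem_iff_content_nsmul_mem`): `N_s ⊆ M_s ⊆ Hdgᵖ(X, ℤ)`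
  (`lefschetzPiece_le_minimalClassPiece`, `minimalClassPiece_le_toIntSubmodule` — `Hdgᵖ(X, ℤ)` is saturated); **`N_s = (s!·d₁⋯d_s)·M_s`**
  (`IsPolarizationType.exists_mem_minimalClassPiece_eq_content_nsmul`: `θ^{∧s} ∧ y = N_s·(γ_s ∧ y)` with the minimal class `γ_s ∈ H^{2s}(X, ℤ)`;
  `IsPolarizationType.map_nsmul_minimalClassPiece_eq`); the `M_s` are INDEPENDENT (`iSupIndep_minimalClassPieces_of_iSupIndep`) and
  **`rk M_s = rk N_s = ρ_pr^{(p−s)}`** (`finrank_minimalClassPiece_eq`).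
* §2 **THE FACTORISATION `I_p = I'_p · ∏_{s ≤ p} (s!·d₁⋯d_s)^{ρ_pr^{(p−s)}}`** of the index `I_p = [Hdgᵖ(X, ℤ) : ⊕_s N_s]` of the integral Lefschetz decomposition
  (g47-#4) through the index `I'_p = [Hdgᵖ(X, ℤ) : ⊕_s M_s] ≥ 1` of the minimal-class decomposition
  (`IsPolarizationType.index_comap_iSup_lefschetzPieces_eq_mul_prod_of_iSupIndep`, data-free `….index_comap_iSup_lefschetzPieces_eq_mul_prod`):
  `[⊕M_s : ⊕N_s] = ∏_s (s!·d₁⋯d_s)^{rk M_s}` by §0; hence **`∏_{s=1}^{p} (s!·d₁⋯d_s)^{ρ_pr^{(p−s)}} ∣ I_p`** (`….prod_content_pow_dvd_index_comap_iSup_lefschetzPieces`),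
  refining g48-#3's `p!·d₁⋯d_p ∣ I_p` (the factor `s = p`, `ρ_pr^{(0)} = 1`) by the factors `d₁^{ρ_pr^{(p−1)}}`, `(2d₁d₂)^{ρ_pr^{(p−2)}}`, ….

## References

* [cite: Lange2023AbelianVarietiesComplex, §5.4.1 Thm. 5.4.2 and (5.22)–(5.23) (PDF p. 275); §7.3.2 (1), (3); §7.2.2; §1.5.1 (PDF p. 51); §2.5.3 Thm. 2.5.16, Cor. 2.5.17 (PDF p. 135)]
* [cite: VoisinHodgeI2002, §6.2.3 Prop. 6.22, Lemma 6.26, Rem. 6.27 (PDF p. 126); §7.1.2 (PDF p. 134)]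
* [cite: BenoistDebarre2023SmoothSubvarietiesJacobians, §1 (p. 3); §3 proof of Thm. 3.7 (p. 7)]
* [cite: Huybrechts2016K3, Ch. 14 §0.1 (PDF p. 333), §0.2]
* [cite: Kaplansky1954, §7 (e) and Thm. 5 (PDF pp. 17–18)]
-/

noncomputable section

-- `Module ℂ` / `SMulZeroClass ℂ` synthesis on `E [⋀^Fin k]→L[ℝ] ℂ` (as in `ComplexTorusLefschetzDecomposition`)
set_option maxSynthPendingDepth 3

open Module Function Complex
open LinearMap (BilinForm)
open Literature.LinearAlgebra.Alternating
open Literature.Analysis.Complex (IsOfTypeAt typeSubmodule mem_typeSubmodule_iff_isOfTypeAt)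

namespace Literature.Geometry.Kaehler.ComplexTorus

/-! ## §0 Lattice generalities: `[⊕ A_s : ⊕ B_s] = ∏ [A_s : B_s]` for independent summands; `[Λ : nΛ] = n^{rk Λ}` -/

section Generic

variable {R V : Type*} [Ring R] [AddCommGroup V] [Module R V]

/-- `(A ⊔ B).toAddSubgroup = A.toAddSubgroup ⊔ B.toAddSubgroup`. [folklore] -/
private theorem sup_toAddSubgroup₉₄ (A B : Submodule R V) : (A ⊔ B).toAddSubgroup = A.toAddSubgroup ⊔ B.toAddSubgroup := by
  refine le_antisymm ?_ (sup_le (Submodule.toAddSubgroup_mono le_sup_left) (Submodule.toAddSubgroup_mono le_sup_right))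
  intro x hx
  obtain ⟨a, ha, b, hb, rfl⟩ := Submodule.mem_sup.1 hx
  exact AddSubgroup.add_mem _ (AddSubgroup.mem_sup_left ha) (AddSubgroup.mem_sup_right hb)

/-- `[A ⊕ B : A ⊕ B'] = [B : B']` for submodules `A`, `B' ⊆ B` with `A ⊓ B = 0` (modular law + second isomorphism theorem). [folklore] -/
private theorem relIndex_sup_left_eq₉₄ {A B B' : Submodule R V} (hAB : A ⊓ B = ⊥) (hB' : B' ≤ B) :
    (A ⊔ B').toAddSubgroup.relIndex (A ⊔ B).toAddSubgroup = B'.toAddSubgroup.relIndex B.toAddSubgroup := by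
  have hmod : (A ⊔ B') ⊓ B = B' := by
    rw [sup_comm A B', sup_inf_assoc_of_le A hB', hAB, sup_bot_eq]
  have hsup : B.toAddSubgroup ⊔ (A ⊔ B').toAddSubgroup = (A ⊔ B).toAddSubgroup := by
    rw [← sup_toAddSubgroup₉₄, sup_left_comm, sup_eq_left.2 hB']
  have hinf : (A ⊔ B').toAddSubgroup ⊓ B.toAddSubgroup = ((A ⊔ B') ⊓ B).toAddSubgroup := AddSubgroup.ext fun _ ↦ Iff.rfl
  calc (A ⊔ B').toAddSubgroup.relIndex (A ⊔ B).toAddSubgroup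
      = (A ⊔ B').toAddSubgroup.relIndex (B.toAddSubgroup ⊔ (A ⊔ B').toAddSubgroup) := by rw [hsup]
    _ = (A ⊔ B').toAddSubgroup.relIndex B.toAddSubgroup := AddSubgroup.relIndex_sup_right _ _
    _ = ((A ⊔ B').toAddSubgroup ⊓ B.toAddSubgroup).relIndex B.toAddSubgroup := (AddSubgroup.inf_relIndex_right _ _).symm
    _ = B'.toAddSubgroup.relIndex B.toAddSubgroup := by rw [hinf, hmod]

/-- **`[⊕_s A_s : ⊕_s B_s] = ∏_s [A_s : B_s]`** for an INDEPENDENT finite family of submodules `A` and submodules `B_s ⊆ A_s`: the quotient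
`(⊕ A_s)/(⊕ B_s)` is `⊕ A_s/B_s` (induction over the summands, each step being `[A ⊕ C : A' ⊕ C'] = [A : A']·[C : C']` from the modular law).
[cite: Kaplansky1954, §7 Thm. 5 (PDF p. 18)] [cite: Huybrechts2016K3, Ch. 14 §0.2] -/
theorem relIndex_iSup_eq_prod_of_iSupIndep {σ : Type*} [Fintype σ] [DecidableEq σ] (A B : σ → Submodule R V) (hA : iSupIndep A)
    (hBA : ∀ s, B s ≤ A s) :
    (⨆ s, B s).toAddSubgroup.relIndex (⨆ s, A s).toAddSubgroup = ∏ s, (B s).toAddSubgroup.relIndex (A s).toAddSubgroup := by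
  -- by induction over finsets of indices
  suffices h : ∀ T : Finset σ, (⨆ s ∈ T, B s).toAddSubgroup.relIndex (⨆ s ∈ T, A s).toAddSubgroup =
      ∏ s ∈ T, (B s).toAddSubgroup.relIndex (A s).toAddSubgroup by
    have hA' : (⨆ s ∈ (Finset.univ : Finset σ), A s) = ⨆ s, A s := by simp
    have hB' : (⨆ s ∈ (Finset.univ : Finset σ), B s) = ⨆ s, B s := by simp
    rw [← hA', ← hB']
    exact h Finset.univ
  intro T
  induction T using Finset.induction_on with
  | empty =>
    have hA0 : (⨆ s ∈ (∅ : Finset σ), A s) = ⊥ := by simp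
    have hB0 : (⨆ s ∈ (∅ : Finset σ), B s) = ⊥ := by simp
    rw [hA0, hB0, Finset.prod_empty, Submodule.bot_toAddSubgroup, AddSubgroup.relIndex_bot_right]
  | insert t T ht ih =>
    rw [Finset.iSup_insert, Finset.iSup_insert, Finset.prod_insert ht, ← ih]
    -- `X = A t`, `X' = B t`, `Y = ⨆_T A`, `Y' = ⨆_T B`; `X ⊓ Y = 0` by independence
    have hXY : A t ⊓ (⨆ s ∈ T, A s) = ⊥ :=
      (hA.disjoint_biSup (y := (↑T : Set σ)) (fun h ↦ ht (Finset.mem_coe.1 h))).eq_bot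
    have hY'Y : (⨆ s ∈ T, B s) ≤ ⨆ s ∈ T, A s := iSup₂_mono fun s _ ↦ hBA s
    have hX'X : B t ≤ A t := hBA t
    have hX'Y : B t ⊓ (⨆ s ∈ T, A s) = ⊥ := eq_bot_iff.2 (le_trans (inf_le_inf_right _ hX'X) hXY.le)
    have hYX : (⨆ s ∈ T, A s) ⊓ A t = ⊥ := by rw [inf_comm]; exact hXY
    have h1 : (B t ⊔ ⨆ s ∈ T, B s).toAddSubgroup ≤ (B t ⊔ ⨆ s ∈ T, A s).toAddSubgroup :=
      Submodule.toAddSubgroup_mono (sup_le_sup_left hY'Y _)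
    have h2 : (B t ⊔ ⨆ s ∈ T, A s).toAddSubgroup ≤ (A t ⊔ ⨆ s ∈ T, A s).toAddSubgroup :=
      Submodule.toAddSubgroup_mono (sup_le_sup_right hX'X _)
    rw [← AddSubgroup.relIndex_mul_relIndex _ _ _ h1 h2, relIndex_sup_left_eq₉₄ hX'Y hY'Y, sup_comm (B t), sup_comm (A t),
      relIndex_sup_left_eq₉₄ hYX hX'X, mul_comm]

/-- **`[Λ : n·Λ] = n^{rk Λ}`** for a sublattice `Λ` (of a torsion-free abelian group) with a finite `ℤ`-basis: the index of `n·Λ` in `Λ` is `n^{rk Λ}`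
(`Λ/nΛ ≅ (ℤ/n)^{rk}`; Mathlib's `AddSubgroup.relIndex_map_nsmul`). [cite: Lange2023AbelianVarietiesComplex, §1.1.2 Prop. 1.1.14 (proof)] [cite: Huybrechts2016K3, Ch. 14 §0.1] -/
theorem relIndex_map_nsmul_eq_pow_card {M : Type*} [AddCommGroup M] (S : Submodule ℤ M) {κ : Type*} [Fintype κ] (b : Basis κ ℤ ↥S) (n : ℕ) :
    (S.toAddSubgroup.map (nsmulAddMonoidHom (α := M) n)).relIndex S.toAddSubgroup = n ^ Fintype.card κ := by
  haveI : Module.Free ℤ ↥S.toAddSubgroup.toIntSubmodule := by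
    rw [Submodule.toAddSubgroup_toIntSubmodule]
    exact Module.Free.of_basis b
  haveI : Module.Finite ℤ ↥S.toAddSubgroup.toIntSubmodule := by
    rw [Submodule.toAddSubgroup_toIntSubmodule]
    exact Module.Finite.of_basis b
  rw [AddSubgroup.relIndex_map_nsmul n S.toAddSubgroup]
  congr 1
  let e : ↥S.toAddSubgroup ≃ₗ[ℤ] ↥S :=
    { toFun := fun z ↦ ⟨(z : M), z.2⟩
      invFun := fun w ↦ ⟨(w : M), w.2⟩
      left_inv := fun _ ↦ rfl
      right_inv := fun _ ↦ rfl
      map_add' := fun _ _ ↦ rfl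
      map_smul' := fun _ _ ↦ rfl }
  rw [e.finrank_eq, finrank_eq_card_basis b]

end Generic

/-! ## §1 The minimal-class pieces `M_s = {u : (s!·d₁⋯d_s)·u ∈ N_s} = γ_s ∧ Hdg^{p−s}(X, ℤ)_prim` -/

section Pieces

variable {ι : Type*} [Fintype ι] [DecidableEq ι] {E : Type*} [NormedAddCommGroup E] [NormedSpace ℂ E]
  {Φ : (ι → ℝ) ≃L[ℝ] E} {j k p : ℕ} {η : E [⋀^Fin 2]→L[ℝ] ℝ} {d : Fin (j + 2) → ℕ}

omit [Fintype ι] [DecidableEq ι] in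
/-- **The minimal-class pieces exist** as sublattices of `Hᵏ(X, ℤ)`: `M_s = {u : (s!·d₁⋯d_s)·u ∈ N_s}` (the pull-back of the Lefschetz piece `N_s` under
multiplication by the content of the type in degree `s`). [cite: Lange2023AbelianVarietiesComplex, §2.5.3 Thm. 2.5.16 (PDF p. 135); §5.4.1 (5.22) (PDF p. 275)] -/
theorem exists_family_mem_iff_content_nsmul_mem (d : Fin (j + 2) → ℕ) (hp : p ≤ j + 2) (N : Fin (p + 1) → Submodule ℤ ↥(integralForms Φ k)) :
    ∃ M : Fin (p + 1) → Submodule ℤ ↥(integralForms Φ k), ∀ (s : Fin (p + 1)) (u : ↥(integralForms Φ k)), u ∈ M s ↔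
      ((s : ℕ).factorial * ∏ i : Fin s, d (Fin.castLE ((Nat.le_of_lt_succ s.isLt).trans hp) i)) • u ∈ N s := by
  refine ⟨fun s ↦ (N s).comap ((((s : ℕ).factorial * ∏ i : Fin s, d (Fin.castLE ((Nat.le_of_lt_succ s.isLt).trans hp) i) : ℕ) : ℤ) •
    (LinearMap.id : ↥(integralForms Φ k) →ₗ[ℤ] ↥(integralForms Φ k))), fun s u ↦ ?_⟩
  rw [Submodule.mem_comap, LinearMap.smul_apply, LinearMap.id_apply, natCast_zsmul]

omit [Fintype ι] [DecidableEq ι] in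
/-- **`N_s ⊆ M_s`**: a Lefschetz piece is contained in its minimal-class piece (`N_s` is a subgroup).
[cite: Lange2023AbelianVarietiesComplex, §5.4.1 (5.22) (PDF p. 275)] -/
theorem lefschetzPiece_le_minimalClassPiece (hp : p ≤ j + 2) (N M : Fin (p + 1) → Submodule ℤ ↥(integralForms Φ k))
    (hM : ∀ (s : Fin (p + 1)) (u : ↥(integralForms Φ k)), u ∈ M s ↔
      ((s : ℕ).factorial * ∏ i : Fin s, d (Fin.castLE ((Nat.le_of_lt_succ s.isLt).trans hp) i)) • u ∈ N s) (s : Fin (p + 1)) :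
    N s ≤ M s :=
  fun _ hv ↦ (hM s _).2 (nsmul_mem hv _)

/-- **`M_s ⊆ Hdgᵖ(X, ℤ)`** (`k = p + p`): `(s!·d₁⋯d_s)·u ∈ N_s ⊆ Hdgᵖ(X, ℤ)` and `Hdgᵖ(X, ℤ)` is saturated in `Hᵏ(X, ℤ)` (the contents are positive).
[cite: Lange2023AbelianVarietiesComplex, §7.2.2; §2.5.3 Thm. 2.5.16 (PDF p. 135)] [cite: Huybrechts2016K3, Ch. 14 §0.1 (PDF p. 333)] -/
theorem IsPolarizationType.minimalClassPiece_le_toIntSubmodule (hd : IsPolarizationType Φ η d) (hη : IsRiemannForm Φ η) (hp : p ≤ j + 2)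
    (hpk : p + p = k) (N : Fin (p + 1) → Submodule ℤ ↥(integralForms Φ k))
    (hN : ∀ (s : Fin (p + 1)) (u : ↥(integralForms Φ k)), u ∈ N s ↔
      ∃ (m i : ℕ) (_ : i + i = m) (h : 2 * (s : ℕ) + m = k) (y : E [⋀^Fin m]→L[ℝ] ℂ),
        y ∈ integralHodgeClassesIn Φ m i ∧ y ∈ primitiveForms η m ∧ (u : E [⋀^Fin k]→L[ℝ] ℂ) = lefschetzPow η (s : ℕ) h y)
    (M : Fin (p + 1) → Submodule ℤ ↥(integralForms Φ k))
    (hM : ∀ (s : Fin (p + 1)) (u : ↥(integralForms Φ k)), u ∈ M s ↔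
      ((s : ℕ).factorial * ∏ i : Fin s, d (Fin.castLE ((Nat.le_of_lt_succ s.isLt).trans hp) i)) • u ∈ N s) (s : Fin (p + 1)) :
    M s ≤ AddSubgroup.toIntSubmodule ((integralHodgeClassesIn Φ k p).addSubgroupOf (integralForms Φ k)) := by
  intro u hu
  have hc : 0 < (s : ℕ).factorial * ∏ i : Fin s, d (Fin.castLE ((Nat.le_of_lt_succ s.isLt).trans hp) i) :=
    Nat.mul_pos (Nat.factorial_pos _) (Finset.prod_pos fun i _ ↦ hd.pos hη _)
  have hmem := iSup_lefschetzPieces_le_toIntSubmodule hη hpk N hN (Submodule.mem_iSup_of_mem s ((hM s u).1 hu))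
  rcases nsmulSaturated_integralHodgeClassesIn_addSubgroupOf Φ k p hmem with h0 | h
  · exact absurd h0 hc.ne'
  · exact h

/-- **`N_s = (s!·d₁⋯d_s)·M_s`: every element of the Lefschetz piece is the content times an element of the minimal-class piece** — `θ^{∧s} ∧ y =
(s!·d₁⋯d_s)·(γ_s ∧ y)` with the integral minimal class `γ_s = θ^{∧s}/(s!·d₁⋯d_s) ∈ H^{2s}(X, ℤ)`, and `γ_s ∧ y ∈ Hᵏ(X, ℤ)`.
[cite: Lange2023AbelianVarietiesComplex, §2.5.3 Thm. 2.5.16, Cor. 2.5.17 (PDF p. 135); §1.5.1 (PDF p. 51); §5.4.1 (5.22) (PDF p. 275)] [cite: BenoistDebarre2023SmoothSubvarietiesJacobians, §1 (p. 3)] -/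
theorem IsPolarizationType.exists_mem_minimalClassPiece_eq_content_nsmul (hd : IsPolarizationType Φ η d) (hp : p ≤ j + 2)
    (N : Fin (p + 1) → Submodule ℤ ↥(integralForms Φ k))
    (hN : ∀ (s : Fin (p + 1)) (u : ↥(integralForms Φ k)), u ∈ N s ↔
      ∃ (m i : ℕ) (_ : i + i = m) (h : 2 * (s : ℕ) + m = k) (y : E [⋀^Fin m]→L[ℝ] ℂ),
        y ∈ integralHodgeClassesIn Φ m i ∧ y ∈ primitiveForms η m ∧ (u : E [⋀^Fin k]→L[ℝ] ℂ) = lefschetzPow η (s : ℕ) h y)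
    (M : Fin (p + 1) → Submodule ℤ ↥(integralForms Φ k))
    (hM : ∀ (s : Fin (p + 1)) (u : ↥(integralForms Φ k)), u ∈ M s ↔
      ((s : ℕ).factorial * ∏ i : Fin s, d (Fin.castLE ((Nat.le_of_lt_succ s.isLt).trans hp) i)) • u ∈ N s)
    (s : Fin (p + 1)) {v : ↥(integralForms Φ k)} (hv : v ∈ N s) :
    ∃ u ∈ M s, v = ((s : ℕ).factorial * ∏ i : Fin s, d (Fin.castLE ((Nat.le_of_lt_succ s.isLt).trans hp) i)) • u := by
  obtain ⟨m, i, hm, h, y, hyH, -, hvy⟩ := (hN s v).1 hv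
  obtain ⟨γ, hγZ, hγ⟩ := hd.exists_mem_integralForms_wedgePow_eq_content_smul (q := (s : ℕ)) ((Nat.le_of_lt_succ s.isLt).trans hp)
  subst h
  set c : ℕ := (s : ℕ).factorial * ∏ i : Fin s, d (Fin.castLE ((Nat.le_of_lt_succ s.isLt).trans hp) i) with hc
  let u : ↥(integralForms Φ (2 * (s : ℕ) + m)) := ⟨γ.wedge y, wedge_mem_integralForms Φ hγZ ((mem_integralHodgeClassesIn_iff Φ).1 hyH).1⟩
  have hvu : v = c • u := by
    apply Subtype.ext
    rw [AddSubmonoidClass.coe_nsmul, ← Nat.cast_smul_eq_nsmul ℂ, hvy, lefschetzPow_apply, domDomCongr_finCongr_self, hγ, wedge_smul_left_complex]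
  refine ⟨u, (hM s u).2 ?_, hvu⟩
  rw [← hvu]
  exact hv

/-- **`(s!·d₁⋯d_s)·M_s = N_s`** as subgroups of `Hᵏ(X, ℤ)`. [cite: Lange2023AbelianVarietiesComplex, §2.5.3 Thm. 2.5.16 (PDF p. 135); §5.4.1 (5.22) (PDF p. 275)] -/
theorem IsPolarizationType.map_nsmul_minimalClassPiece_eq (hd : IsPolarizationType Φ η d) (hp : p ≤ j + 2)
    (N : Fin (p + 1) → Submodule ℤ ↥(integralForms Φ k))
    (hN : ∀ (s : Fin (p + 1)) (u : ↥(integralForms Φ k)), u ∈ N s ↔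
      ∃ (m i : ℕ) (_ : i + i = m) (h : 2 * (s : ℕ) + m = k) (y : E [⋀^Fin m]→L[ℝ] ℂ),
        y ∈ integralHodgeClassesIn Φ m i ∧ y ∈ primitiveForms η m ∧ (u : E [⋀^Fin k]→L[ℝ] ℂ) = lefschetzPow η (s : ℕ) h y)
    (M : Fin (p + 1) → Submodule ℤ ↥(integralForms Φ k))
    (hM : ∀ (s : Fin (p + 1)) (u : ↥(integralForms Φ k)), u ∈ M s ↔
      ((s : ℕ).factorial * ∏ i : Fin s, d (Fin.castLE ((Nat.le_of_lt_succ s.isLt).trans hp) i)) • u ∈ N s) (s : Fin (p + 1)) :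
    (M s).toAddSubgroup.map (nsmulAddMonoidHom (α := ↥(integralForms Φ k))
      ((s : ℕ).factorial * ∏ i : Fin s, d (Fin.castLE ((Nat.le_of_lt_succ s.isLt).trans hp) i))) = (N s).toAddSubgroup := by
  ext v
  rw [AddSubgroup.mem_map, Submodule.mem_toAddSubgroup]
  constructor
  · rintro ⟨u, hu, rfl⟩
    rw [nsmulAddMonoidHom_apply]
    exact (hM s u).1 hu
  · intro hv
    obtain ⟨u, hu, hvu⟩ := hd.exists_mem_minimalClassPiece_eq_content_nsmul hp N hN M hM s hv
    exact ⟨u, hu, by rw [nsmulAddMonoidHom_apply, hvu]⟩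

/-- **The minimal-class pieces are INDEPENDENT** when the Lefschetz pieces are: a common multiple `C = ∏_t (t!·d₁⋯d_t)` carries `M_s` into `N_s`, so an
element of `M_s ∩ Σ_{t ≠ s} M_t` is killed by `C` (independence of the `N`), hence is `0` (`Hᵏ(X, ℤ)` is torsion free).
[cite: Lange2023AbelianVarietiesComplex, §5.4.1 Thm. 5.4.2 and (5.22) (PDF p. 275); §7.3.2 (3)] [cite: VoisinHodgeI2002, §6.2.3 Prop. 6.22, Rem. 6.27 (PDF p. 126)] -/
theorem IsPolarizationType.iSupIndep_minimalClassPieces_of_iSupIndep (hd : IsPolarizationType Φ η d) (hη : IsRiemannForm Φ η) (hp : p ≤ j + 2)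
    (N M : Fin (p + 1) → Submodule ℤ ↥(integralForms Φ k))
    (hM : ∀ (s : Fin (p + 1)) (u : ↥(integralForms Φ k)), u ∈ M s ↔
      ((s : ℕ).factorial * ∏ i : Fin s, d (Fin.castLE ((Nat.le_of_lt_succ s.isLt).trans hp) i)) • u ∈ N s)
    (hind : iSupIndep N) : iSupIndep M := by
  -- a common multiple of the contents
  set C : ℕ := ∏ t : Fin (p + 1), ((t : ℕ).factorial * ∏ i : Fin t, d (Fin.castLE ((Nat.le_of_lt_succ t.isLt).trans hp) i)) with hC
  have hC0 : 0 < C := Finset.prod_pos fun t _ ↦ Nat.mul_pos (Nat.factorial_pos _) (Finset.prod_pos fun i _ ↦ hd.pos hη _)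
  have hCN : ∀ t, ∀ x ∈ M t, C • x ∈ N t := fun t x hx ↦ by
    obtain ⟨r, hr⟩ : ((t : ℕ).factorial * ∏ i : Fin t, d (Fin.castLE ((Nat.le_of_lt_succ t.isLt).trans hp) i)) ∣ C :=
      Finset.dvd_prod_of_mem _ (Finset.mem_univ t)
    rw [hr, mul_comm, mul_nsmul']
    exact nsmul_mem ((hM t x).1 hx) r
  rw [iSupIndep_def]
  intro s
  rw [Submodule.disjoint_def]
  intro u hu hu'
  have h1 : C • u ∈ N s := hCN s u hu
  have h2 : C • u ∈ ⨆ (t) (_ : t ≠ s), N t := by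
    refine Submodule.iSup_induction (fun t ↦ ⨆ (_ : t ≠ s), M t) (motive := fun x ↦ C • x ∈ ⨆ (t) (_ : t ≠ s), N t) hu' ?_ ?_ ?_
    · intro t x hx
      by_cases hts : t ≠ s
      · rw [iSup_pos hts] at hx
        refine Submodule.mem_iSup_of_mem t ?_
        rw [iSup_pos hts]
        exact hCN t x hx
      · rw [iSup_neg hts, Submodule.mem_bot] at hx
        rw [hx, smul_zero]
        exact Submodule.zero_mem _
    · rw [smul_zero]
      exact Submodule.zero_mem _
    · intro x y hx hy
      rw [smul_add]
      exact Submodule.add_mem _ hx hy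
  have h0 : C • u = 0 := (Submodule.disjoint_def.1 (iSupIndep_def.1 hind s)) _ h1 h2
  have h' := congrArg (fun z : ↥(integralForms Φ k) ↦ (z : E [⋀^Fin k]→L[ℝ] ℂ)) h0
  simp only [AddSubmonoidClass.coe_nsmul, ZeroMemClass.coe_zero] at h'
  rw [← Nat.cast_smul_eq_nsmul ℂ, smul_eq_zero] at h'
  exact Subtype.ext (h'.resolve_left (by exact_mod_cast hC0.ne'))

/-- **`rk M_s = rk N_s`**: `N_s ⊆ M_s` and `u ↦ (s!·d₁⋯d_s)·u` embeds `M_s` into `N_s`. [cite: Lange2023AbelianVarietiesComplex, §5.4.1 (5.22)–(5.23) (PDF p. 275); §7.3.2 (3)] -/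
theorem IsPolarizationType.finrank_minimalClassPiece_eq (hd : IsPolarizationType Φ η d) (hη : IsRiemannForm Φ η) (hp : p ≤ j + 2)
    (N M : Fin (p + 1) → Submodule ℤ ↥(integralForms Φ k))
    (hM : ∀ (s : Fin (p + 1)) (u : ↥(integralForms Φ k)), u ∈ M s ↔
      ((s : ℕ).factorial * ∏ i : Fin s, d (Fin.castLE ((Nat.le_of_lt_succ s.isLt).trans hp) i)) • u ∈ N s) (s : Fin (p + 1)) :
    finrank ℤ ↥(M s) = finrank ℤ ↥(N s) := by
  classical
  letI : LinearOrder ι := LinearOrder.lift' (Fintype.equivFin ι) (Fintype.equivFin ι).injective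
  haveI : Module.Finite ℤ ↥(integralForms Φ k) := Module.Finite.of_basis (intLatMonomialBasis Φ k)
  set c : ℕ := (s : ℕ).factorial * ∏ i : Fin s, d (Fin.castLE ((Nat.le_of_lt_succ s.isLt).trans hp) i) with hc
  have hc0 : (c : ℂ) ≠ 0 := by
    exact_mod_cast (Nat.mul_pos (Nat.factorial_pos _) (Finset.prod_pos fun i _ ↦ hd.pos hη _)).ne'
  refine le_antisymm ?_ (Submodule.finrank_mono (lefschetzPiece_le_minimalClassPiece hp N M hM s))
  -- `u ↦ c • u : M_s → N_s` is injective
  let f : ↥(M s) →ₗ[ℤ] ↥(N s) := LinearMap.codRestrict (N s) ((c : ℤ) • (M s).subtype) fun u ↦ by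
    rw [LinearMap.smul_apply, Submodule.subtype_apply, natCast_zsmul]
    exact (hM s _).1 u.2
  have hf : Injective f := fun x y hxy ↦ by
    have h' := congrArg (fun w : ↥(N s) ↦ ((w : ↥(integralForms Φ k)) : E [⋀^Fin k]→L[ℝ] ℂ)) hxy
    simp only [f, LinearMap.codRestrict_apply, LinearMap.smul_apply, Submodule.subtype_apply, natCast_zsmul, AddSubmonoidClass.coe_nsmul] at h'
    rw [← Nat.cast_smul_eq_nsmul ℂ, ← Nat.cast_smul_eq_nsmul ℂ] at h'
    exact Subtype.ext (Subtype.ext (smul_right_injective (E [⋀^Fin k]→L[ℝ] ℂ) hc0 h'))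
  exact LinearMap.finrank_le_finrank_of_injective hf

/-- **`rk M_s = ρ_pr^{(p−s)}`** (`k = p + p ≤ g`): the minimal-class piece has the rank of the primitive Hodge lattice `Hdg^{p−s}(X, ℤ) ∩ P^{2(p−s)}` (g47-#4).
[cite: Lange2023AbelianVarietiesComplex, §7.3.2 (1), (3); §5.4.1 (5.22) (PDF p. 275)] -/
theorem IsPolarizationType.finrank_minimalClassPiece_eq_finrank_primitive (hd : IsPolarizationType Φ η d) (hη : IsRiemannForm Φ η) (hp : p ≤ j + 2)
    (hpk : p + p = k) (hk : k ≤ j + 2) (N : Fin (p + 1) → Submodule ℤ ↥(integralForms Φ k))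
    (hN : ∀ (s : Fin (p + 1)) (u : ↥(integralForms Φ k)), u ∈ N s ↔
      ∃ (m i : ℕ) (_ : i + i = m) (h : 2 * (s : ℕ) + m = k) (y : E [⋀^Fin m]→L[ℝ] ℂ),
        y ∈ integralHodgeClassesIn Φ m i ∧ y ∈ primitiveForms η m ∧ (u : E [⋀^Fin k]→L[ℝ] ℂ) = lefschetzPow η (s : ℕ) h y)
    (M : Fin (p + 1) → Submodule ℤ ↥(integralForms Φ k))
    (hM : ∀ (s : Fin (p + 1)) (u : ↥(integralForms Φ k)), u ∈ M s ↔
      ((s : ℕ).factorial * ∏ i : Fin s, d (Fin.castLE ((Nat.le_of_lt_succ s.isLt).trans hp) i)) • u ∈ N s) (s : Fin (p + 1)) :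
    finrank ℤ ↥(M s) =
      finrank ℤ ↥(integralHodgeClassesIn Φ (2 * (p - (s : ℕ))) (p - (s : ℕ)) ⊓ (primitiveForms η (2 * (p - (s : ℕ)))).toAddSubgroup) := by
  rw [hd.finrank_minimalClassPiece_eq hη hp N M hM s, hd.finrank_lefschetzPiece_eq_of_family hη hpk hk N hN s]

end Pieces

/-! ## §2 The factorisation `I_p = I'_p · ∏_s (s!·d₁⋯d_s)^{ρ_pr^{(p−s)}}` -/

section Factorisation

variable {ι : Type*} [Fintype ι] [DecidableEq ι] {E : Type*} [NormedAddCommGroup E] [NormedSpace ℂ E]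
  {Φ : (ι → ℝ) ≃L[ℝ] E} {j k p : ℕ} {η : E [⋀^Fin 2]→L[ℝ] ℝ} {d : Fin (j + 2) → ℕ}

/-- **`[⊕_s M_s : ⊕_s N_s] = ∏_s (s!·d₁⋯d_s)^{rk M_s}`**: the minimal-class decomposition contains the Lefschetz decomposition with index the product of the
`[M_s : (s!·d₁⋯d_s)·M_s] = (s!·d₁⋯d_s)^{rk M_s}` (§0: the `M_s` are independent, `N_s = (s!·d₁⋯d_s)·M_s`, `M_s` free with a finite basis).
[cite: Lange2023AbelianVarietiesComplex, §5.4.1 Thm. 5.4.2 and (5.22)–(5.23) (PDF p. 275); §2.5.3 Thm. 2.5.16 (PDF p. 135)] [cite: Huybrechts2016K3, Ch. 14 §0.1, §0.2] [cite: Kaplansky1954, §7 Thm. 5 (PDF p. 18)] -/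
theorem IsPolarizationType.relIndex_iSup_lefschetzPieces_iSup_minimalClassPieces (hd : IsPolarizationType Φ η d) (hη : IsRiemannForm Φ η)
    (hp : p ≤ j + 2) (N : Fin (p + 1) → Submodule ℤ ↥(integralForms Φ k))
    (hN : ∀ (s : Fin (p + 1)) (u : ↥(integralForms Φ k)), u ∈ N s ↔
      ∃ (m i : ℕ) (_ : i + i = m) (h : 2 * (s : ℕ) + m = k) (y : E [⋀^Fin m]→L[ℝ] ℂ),
        y ∈ integralHodgeClassesIn Φ m i ∧ y ∈ primitiveForms η m ∧ (u : E [⋀^Fin k]→L[ℝ] ℂ) = lefschetzPow η (s : ℕ) h y)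
    (M : Fin (p + 1) → Submodule ℤ ↥(integralForms Φ k))
    (hM : ∀ (s : Fin (p + 1)) (u : ↥(integralForms Φ k)), u ∈ M s ↔
      ((s : ℕ).factorial * ∏ i : Fin s, d (Fin.castLE ((Nat.le_of_lt_succ s.isLt).trans hp) i)) • u ∈ N s)
    (hind : iSupIndep N) :
    (⨆ s, N s).toAddSubgroup.relIndex (⨆ s, M s).toAddSubgroup =
      ∏ s : Fin (p + 1), ((s : ℕ).factorial * ∏ i : Fin s, d (Fin.castLE ((Nat.le_of_lt_succ s.isLt).trans hp) i)) ^ finrank ℤ ↥(M s) := by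
  classical
  letI : LinearOrder ι := LinearOrder.lift' (Fintype.equivFin ι) (Fintype.equivFin ι).injective
  rw [relIndex_iSup_eq_prod_of_iSupIndep M N (hd.iSupIndep_minimalClassPieces_of_iSupIndep hη hp N M hM hind)
    (lefschetzPiece_le_minimalClassPiece hp N M hM)]
  refine Finset.prod_congr rfl fun s _ ↦ ?_
  obtain ⟨r, b⟩ := Submodule.basisOfPid (intLatMonomialBasis Φ k) (M s)
  rw [← hd.map_nsmul_minimalClassPiece_eq hp N hN M hM s, relIndex_map_nsmul_eq_pow_card (M s) b]
  congr 1
  exact (finrank_eq_card_basis b).symm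

omit [Fintype ι] [DecidableEq ι] in
/-- The index of a pull-back along `Hdgᵖ(X, ℤ) ↪ Hᵏ(X, ℤ)` (the currency of g47-#4) is a relative index: for sublattices `S ⊆ S⁺` of `Hᵏ(X, ℤ)` with `S⁺ ⊆ Hdgᵖ(X, ℤ)`,
`[Hdgᵖ(X, ℤ) : S] = [S⁺ : S] · [Hdgᵖ(X, ℤ) : S⁺]`. [cite: Huybrechts2016K3, Ch. 14 §0.1] -/
theorem index_comap_inclusion_eq_relIndex_mul (S S' : Submodule ℤ ↥(integralForms Φ k)) (hle : S ≤ S')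
    (hS' : S' ≤ AddSubgroup.toIntSubmodule ((integralHodgeClassesIn Φ k p).addSubgroupOf (integralForms Φ k))) :
    (S.comap (AddSubgroup.inclusion (integralHodgeClassesIn_le_integralForms Φ k p)).toIntLinearMap).toAddSubgroup.index =
      S.toAddSubgroup.relIndex S'.toAddSubgroup *
        (S'.comap (AddSubgroup.inclusion (integralHodgeClassesIn_le_integralForms Φ k p)).toIntLinearMap).toAddSubgroup.index := by
  have hcomap : ∀ X : Submodule ℤ ↥(integralForms Φ k),
      (X.comap (AddSubgroup.inclusion (integralHodgeClassesIn_le_integralForms Φ k p)).toIntLinearMap).toAddSubgroup =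
        X.toAddSubgroup.comap (AddSubgroup.inclusion (integralHodgeClassesIn_le_integralForms Φ k p)) := fun X ↦ AddSubgroup.ext fun _ ↦ Iff.rfl
  have hle' : (S.comap (AddSubgroup.inclusion (integralHodgeClassesIn_le_integralForms Φ k p)).toIntLinearMap).toAddSubgroup ≤
      (S'.comap (AddSubgroup.inclusion (integralHodgeClassesIn_le_integralForms Φ k p)).toIntLinearMap).toAddSubgroup :=
    fun x hx ↦ hle hx
  rw [← AddSubgroup.relIndex_mul_index hle', hcomap S, hcomap S', AddSubgroup.relIndex_comap, AddSubgroup.map_comap_eq]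
  congr 2
  refine inf_eq_right.2 fun x hx ↦ ?_
  exact ⟨⟨(x : E [⋀^Fin k]→L[ℝ] ℂ), AddSubgroup.mem_addSubgroupOf.1 (hS' hx)⟩, Subtype.ext rfl⟩

/-- **THE FACTORISATION OF THE INDEX OF THE INTEGRAL LEFSCHETZ DECOMPOSITION THROUGH THE MINIMAL CLASSES:
`[Hdgᵖ(X, ℤ) : ⊕_s θ^{∧s} ∧ Hdg^{p−s}(X, ℤ)_prim] = (∏_{s ≤ p} (s!·d₁⋯d_s)^{rk M_s}) · [Hdgᵖ(X, ℤ) : ⊕_s γ_s ∧ Hdg^{p−s}(X, ℤ)_prim]`** (`k = p + p ≤ g`; indices of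
the pull-backs along `Hdgᵖ(X, ℤ) ↪ Hᵏ(X, ℤ)`; `rk M_s = ρ_pr^{(p−s)}`; given the independence of the Lefschetz pieces, supplied data-free below).
[cite: Lange2023AbelianVarietiesComplex, §5.4.1 Thm. 5.4.2 and (5.22)–(5.23) (PDF p. 275); §2.5.3 Thm. 2.5.16, Cor. 2.5.17 (PDF p. 135); §7.3.2 (1), (3)]
[cite: BenoistDebarre2023SmoothSubvarietiesJacobians, §1 (p. 3); §3 proof of Thm. 3.7 (p. 7)] [cite: Huybrechts2016K3, Ch. 14 §0.1, §0.2] -/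
theorem IsPolarizationType.index_comap_iSup_lefschetzPieces_eq_prod_mul_of_iSupIndep (hd : IsPolarizationType Φ η d)
    (hη : IsRiemannForm Φ η) (hp : p ≤ j + 2) (hpk : p + p = k) (N : Fin (p + 1) → Submodule ℤ ↥(integralForms Φ k))
    (hN : ∀ (s : Fin (p + 1)) (u : ↥(integralForms Φ k)), u ∈ N s ↔
      ∃ (m i : ℕ) (_ : i + i = m) (h : 2 * (s : ℕ) + m = k) (y : E [⋀^Fin m]→L[ℝ] ℂ),
        y ∈ integralHodgeClassesIn Φ m i ∧ y ∈ primitiveForms η m ∧ (u : E [⋀^Fin k]→L[ℝ] ℂ) = lefschetzPow η (s : ℕ) h y)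
    (M : Fin (p + 1) → Submodule ℤ ↥(integralForms Φ k))
    (hM : ∀ (s : Fin (p + 1)) (u : ↥(integralForms Φ k)), u ∈ M s ↔
      ((s : ℕ).factorial * ∏ i : Fin s, d (Fin.castLE ((Nat.le_of_lt_succ s.isLt).trans hp) i)) • u ∈ N s)
    (hind : iSupIndep N) :
    ((⨆ s, N s).comap (AddSubgroup.inclusion (integralHodgeClassesIn_le_integralForms Φ k p)).toIntLinearMap).toAddSubgroup.index =
      (∏ s : Fin (p + 1), ((s : ℕ).factorial * ∏ i : Fin s, d (Fin.castLE ((Nat.le_of_lt_succ s.isLt).trans hp) i)) ^ finrank ℤ ↥(M s)) *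
        ((⨆ s, M s).comap (AddSubgroup.inclusion (integralHodgeClassesIn_le_integralForms Φ k p)).toIntLinearMap).toAddSubgroup.index := by
  rw [index_comap_inclusion_eq_relIndex_mul (⨆ s, N s) (⨆ s, M s) (iSup_mono fun s ↦ lefschetzPiece_le_minimalClassPiece hp N M hM s)
    (iSup_le fun s ↦ hd.minimalClassPiece_le_toIntSubmodule hη hp hpk N hN M hM s),
    hd.relIndex_iSup_lefschetzPieces_iSup_minimalClassPieces hη hp N hN M hM hind]

/-- **THE FACTORISATION, DATA-FREE, WITH THE RANKS IDENTIFIED: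
`I_p = [Hdgᵖ(X, ℤ) : ⊕_{s ≤ p} Lˢ Hdg^{p−s}(X, ℤ)_prim] = (∏_{s ≤ p} (s!·d₁⋯d_s)^{ρ_pr^{(p−s)}}) · I'_p`**, `I'_p = [Hdgᵖ(X, ℤ) : ⊕_s γ_s ∧ Hdg^{p−s}(X, ℤ)_prim] ≥ 1` the
index of the Lefschetz decomposition with MINIMAL classes (`k = p + p ≤ g`; the Lefschetz form making the pieces independent, g47-#3, is produced inside),
and the consequences **`∏_{s ≤ p} (s!·d₁⋯d_s)^{ρ_pr^{(p−s)}} ∣ I_p`**, `I'_p ∣ I_p`, `0 < I'_p` — the exact contribution of the divisibility of the powers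
`θ^{∧s}` to the failure of Lange's (5.22) over `ℤ` on the Hodge lattice; what is left, `I'_p`, is the index of the decomposition by the OPTIMAL integral
generators `γ_s` of the Lefschetz lines. [cite: Lange2023AbelianVarietiesComplex, §5.4.1 Thm. 5.4.2 and (5.22)–(5.23) (PDF p. 275); §2.5.3 Thm. 2.5.16, Cor. 2.5.17 (PDF p. 135); §7.3.2 (1), (3); §7.2.2]
[cite: VoisinHodgeI2002, §6.2.3 Prop. 6.22, Rem. 6.27 (PDF p. 126); §7.1.2 (PDF p. 134)] [cite: BenoistDebarre2023SmoothSubvarietiesJacobians, §1 (p. 3); §3 proof of Thm. 3.7 (p. 7)] -/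
theorem IsPolarizationType.index_comap_iSup_lefschetzPieces_eq_prod_mul (hd : IsPolarizationType Φ η d) (hη : IsRiemannForm Φ η)
    (hpk : p + p = k) (hk : k ≤ j + 2) (N : Fin (p + 1) → Submodule ℤ ↥(integralForms Φ k))
    (hN : ∀ (s : Fin (p + 1)) (u : ↥(integralForms Φ k)), u ∈ N s ↔
      ∃ (m i : ℕ) (_ : i + i = m) (h : 2 * (s : ℕ) + m = k) (y : E [⋀^Fin m]→L[ℝ] ℂ),
        y ∈ integralHodgeClassesIn Φ m i ∧ y ∈ primitiveForms η m ∧ (u : E [⋀^Fin k]→L[ℝ] ℂ) = lefschetzPow η (s : ℕ) h y)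
    (hp : p ≤ j + 2) (M : Fin (p + 1) → Submodule ℤ ↥(integralForms Φ k))
    (hM : ∀ (s : Fin (p + 1)) (u : ↥(integralForms Φ k)), u ∈ M s ↔
      ((s : ℕ).factorial * ∏ i : Fin s, d (Fin.castLE ((Nat.le_of_lt_succ s.isLt).trans hp) i)) • u ∈ N s) :
    ((⨆ s, N s).comap (AddSubgroup.inclusion (integralHodgeClassesIn_le_integralForms Φ k p)).toIntLinearMap).toAddSubgroup.index =
      (∏ s : Fin (p + 1), ((s : ℕ).factorial * ∏ i : Fin s, d (Fin.castLE ((Nat.le_of_lt_succ s.isLt).trans hp) i)) ^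
          finrank ℤ ↥(integralHodgeClassesIn Φ (2 * (p - (s : ℕ))) (p - (s : ℕ)) ⊓ (primitiveForms η (2 * (p - (s : ℕ)))).toAddSubgroup)) *
        ((⨆ s, M s).comap (AddSubgroup.inclusion (integralHodgeClassesIn_le_integralForms Φ k p)).toIntLinearMap).toAddSubgroup.index ∧
    (∏ s : Fin (p + 1), ((s : ℕ).factorial * ∏ i : Fin s, d (Fin.castLE ((Nat.le_of_lt_succ s.isLt).trans hp) i)) ^
          finrank ℤ ↥(integralHodgeClassesIn Φ (2 * (p - (s : ℕ))) (p - (s : ℕ)) ⊓ (primitiveForms η (2 * (p - (s : ℕ)))).toAddSubgroup)) ∣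
      ((⨆ s, N s).comap (AddSubgroup.inclusion (integralHodgeClassesIn_le_integralForms Φ k p)).toIntLinearMap).toAddSubgroup.index ∧
    ((⨆ s, M s).comap (AddSubgroup.inclusion (integralHodgeClassesIn_le_integralForms Φ k p)).toIntLinearMap).toAddSubgroup.index ∣
      ((⨆ s, N s).comap (AddSubgroup.inclusion (integralHodgeClassesIn_le_integralForms Φ k p)).toIntLinearMap).toAddSubgroup.index ∧
    0 < ((⨆ s, M s).comap (AddSubgroup.inclusion (integralHodgeClassesIn_le_integralForms Φ k p)).toIntLinearMap).toAddSubgroup.index := by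
  -- the Lefschetz form of degree `k`, for the independence of the pieces
  obtain ⟨q, hkq⟩ : ∃ q, k + q = j + 2 := ⟨j + 2 - k, by omega⟩
  have hq : q ≤ j + 2 := by omega
  obtain ⟨γq, hγqZ, hγq⟩ := hd.exists_mem_integralForms_wedgePow_eq_content_smul hq
  have hcard : Fintype.card ι = k + (2 * q + k) := by rw [hd.card_eq]; omega
  let e : Fin (k + (2 * q + k)) ≃ ι := (Fintype.equivFinOfCardEq hcard).symm
  obtain ⟨B, hB⟩ := exists_bilinForm_eq_poincarePairing_wedge_of_degree Φ hγqZ e rfl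
  obtain ⟨hind, -, -⟩ := hd.iSupIndep_lefschetzPieces hη hkq hq hγq e rfl hB N hN
  have hfac := hd.index_comap_iSup_lefschetzPieces_eq_prod_mul_of_iSupIndep hη hp hpk N hN M hM hind
  simp_rw [hd.finrank_minimalClassPiece_eq_finrank_primitive hη hp hpk hk N hN M hM] at hfac
  have hpos := hd.index_comap_iSup_lefschetzPieces_pos hη hpk hk N hN
  refine ⟨hfac, ⟨_, hfac⟩, ⟨_, hfac.trans (mul_comm _ _)⟩, Nat.pos_of_ne_zero fun h0 ↦ ?_⟩
  rw [hfac, h0, mul_zero] at hpos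
  exact lt_irrefl 0 hpos

end Factorisation

end Literature.Geometry.Kaehler.ComplexTorus

end
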